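/-
Copyright (c) 2026. All rights reserved.
Released under Apache 2.0 license as described in the file LICENSE.
Authors: abc-iut cell, seat abc-iut-f-069 (gen 8; row «P13-V1-SCOPE@DEHN-TWIST»).
-/
import Literature.AnabelianGeometry.AbsoluteAnabelian.AbsTopII.DehnTwistEdgeTorusCentralizer
import Literature.AnabelianGeometry.AbsoluteAnabelian.AbsTopII.DehnTwistLoopProp13i
import Literature.AnabelianGeometry.AbsoluteAnabelian.AbsTopII.DehnTwistLoopProp13vPrime
import Literature.AnabelianGeometry.AbsoluteAnabelian.AbsTopII.DehnTwistVertexTerminal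
import Literature.AnabelianGeometry.AbsoluteAnabelian.AbsTopII.Prop13ConjugacyScopeBridge
import Literature.AnabelianGeometry.AbsoluteAnabelian.AbsTopII.Prop13xLabelScope
import HarnessLib

/-!
# [AbsTopII] Prop 1.3 at the one-vertex nodal Dehn-twist datum: the `Π_H`-scope (v1) predicates (viii), (x), (x′)

S. Mochizuki, *Topics in Absolute Anabelian Geometry II* [AbsTopII] (bib `MochizukiAbsTopII2013`; locators =
PDF pages of the kurims manuscript `paper:url-585b8d0ad0d9`), §1 Def 1.2 (ii) p. 10 ("each vertex `v` (resp. edge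
`e`) [...] determines [up to conjugation in `Π_𝔾`] a subgroup"), Prop 1.3 (viii) p. 12, Prop 1.3 (x) p. 12:

> "(viii) Let `e, e'` be edges of `𝔾`.  If `D_e ∩ D_{e'} ∩ Π_I ≠ {1}`, then one of the following two [mutually
> exclusive] properties holds: (1) `e = e'`; (2) `e` and `e'` are distinct, but abut to the same vertex `v`, and
> `D_e ∩ D_{e'} ∩ Π_𝔾 = {1}`.  Moreover, in the situation of (2), [for appropriate choices of conjugates of the
> various inertia and decomposition groups involved] we have `I_v = D_e ∩ D_{e'} ∩ Π_I`."

PROOF-ONLY companion (abc-iut-f-069 gen 8) of the nodal Dehn-twist datum `DehnTwist.dpsc i hi`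
(`AbsTopII/DehnTwistLoopDatum.lean`: ONE vertex `v`, ONE loop node `e`, ONE cusp `c` on `Π_𝔾 = F̂₂ × 1` inside
`Π_H = Π_I = F̂₂ ⋊_{shear^i} Ẑ`, `H = I = Ẑ` acting by the Dehn twist of speed `i ≥ 1`).  After the lineage's gens
3–7 and abc-iut-L4-t6's files every typed item of Prop 1.3 is decided at this datum EXCEPT the three typings whose
conjugating elements range over all of `Π_H` instead of the printed `Π_𝔾` (finding F-L4t6g5-1 / erratum E-L4-9:
`DPSCIndexData.Prop_1_3_viii`, `Prop_1_3_x` of `InertiaGroups.lean` p405221; and the free-label successor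
`Prop_1_3_x'` of `InertiaGroupsScope.lean` p427207, finding F-L4t6g6-1).  They are DECIDED here, with NO hypothesis:

* §1 `Iv_le_DEdge_dpsc`, `exists_mem_PiG_conj_DEdge_eq_dpsc` — the twist section `1 ⋊ Ẑ` lies in BOTH edge
  decomposition groups `D_e = b^Ẑ ⋊ Ẑ`, `D_c = c^Ẑ ⋊ Ẑ` (abc-iut-L4-t6's `normalizer_node_inf_normalizer_cusp_eq_range_inr`,
  `DehnTwistLoopEdgePair.lean`), and `Π_I = (F̂₂ × 1)·(1 ⋊ Ẑ)`; hence EVERY `Π_H`-conjugate of `D_ε` is already a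
  `Π_𝔾`-conjugate (abc-iut-L4-t6's `conj_smul_eq_conj_inl_left_smul`, `DehnTwistLoopLogPoints.lean`) — the outer
  action of `H` on `Π_𝔾` FIXES the dual graph although it is NOT trivial;
* §2 **`prop_1_3_viii_dpsc_holds`** — the v1 (`Π_H`-scope) typing `DPSCIndexData.Prop_1_3_viii` HOLDS at `dpsc i hi`:
  abc-iut-L4-t6's bridge `prop_1_3_viii_of_prop_1_3_viii'` over gen 7's `prop_1_3_viii'_dpsc_holds` (p500779);
* §3 **`not_prop_1_3_x_dpsc_holds`**, **`not_prop_1_3_x'_dpsc_holds`** — the free-label typings (x) v1 and (x′) v2 FAIL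
  at `dpsc i hi`: the labelled section (`I_v = 1 ⋊ Ẑ`, "the node `e`") is verticial (abc-iut-L4-t6's certificates
  `not_prop_1_3_x(')_of_node`, `Prop13xLabelScope.lean`, fed with the lineage's `prop13iii_dpsc_holds`
  (`DehnTwistLoopProp13ii.lean`) and `I_v` closed); the statement of record `Prop_1_3_x''` HOLDS here (abc-iut-L4-t6
  `prop_1_3_x''_dpsc_holds`, `DehnTwistLoopLogPoints.lean`);
* §4 `centralizer_range_inl_eq_bot` / `centralizer_PiG_dpsc_eq_bot`, `mem_PiG_of_forall_conj_eq_dpsc`, `PiG_ne_PiI_dpsc` — HONESTY OF "NON-TRIVIAL":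
  `Z_{Π_I}(Π_𝔾) = 1` (an element centralising `Π_𝔾` centralises `Π_v × 1`, so lies in `I_v = 1 ⋊ Ẑ`, and `(1,k)`
  moves the stable letter `a ↦ a·b^{k^i}` unless `k^i = 1`, i.e. `k = 1`, `Ẑ` being torsion-free), so the outer
  representation `I → Out(Π_𝔾)` is INJECTIVE, and `I ≅ Ẑ ≠ 1`;
* §5 `exists_nodal_model_prop_1_3_viii_v1_of_faithful_outer_action` — census existence form;
* §6 **`prop_1_3_typed_column_dpsc`** — the COMPLETE DECISION VECTOR of the cell's typed Prop 1.3 predicates at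
  `dpsc i hi` in ONE kernel statement: 19 conjuncts (17 hold, incl. the statement of record (x″) for the model's log
  points — i.e. `LogPointData.Prop13x` at each of them; the two free-label typings (x)/(x′) fail), every conjunct a
  theorem of this lineage / abc-iut-L4-t6 BY NAME.
RESULT IN ONE LINE: at BOTH nodal data of the tree (this one-vertex loop datum; abc-iut-f-066's two-vertex datum,
`TwoTripodNodalPiHScope.lean` p500834) every typed Prop 1.3 predicate is now decided, and the v1 `Π_H`-scope of
(viii) fails ONLY through outer actions that MOVE EDGES (`Prop13ConjugacyScope.lean`, p425481) — not through
non-trivial, indeed faithful, outer actions that fix the dual graph.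
HONEST FRAMING: classical profinite group theory at a constructed model (constructed ≠ geometric: that these closed
subgroups ARE the verticial / edge-like subgroups of the degenerating once-punctured genus-one curve is the model's
label); instance decisions for the cell's typed rows, not the printed theorem for stable log curves; nothing here
bears on [IUTchIII] Cor 3.12; no side taken; typed ≠ proved.
-/

noncomputable section

open scoped Pointwise

namespace Literature.AnabelianGeometry.AbsoluteAnabelian.AbsTopII.DehnTwist

open Literature.AnabelianGeometry.EtaleTheta.SettingModel
open _root_.Topology

variable (i : ℕ)

/-! ### §1 The twist section lies in every edge decomposition group (`Ext`-level, then `dpsc`) -/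

/-- `1 ⋊ Ẑ ≤ D_e = N_{Π_I}(b^Ẑ × 1)` (the twist fixes the vanishing cycle). [cite: MochizukiAbsTopII2013, Def 1.2 (ii) p.10] -/
theorem range_inr_le_normalizer_map_inl_nodeGp :
    (SemidirectProduct.inr : ZH →* Ext i).range ≤
      Subgroup.normalizer ((nodeGp.map (SemidirectProduct.inl : F₂hatT →* Ext i) : Subgroup (Ext i)) : Set (Ext i)) :=
  le_trans (normalizer_node_inf_normalizer_cusp_eq_range_inr i).ge inf_le_left

/-- `1 ⋊ Ẑ ≤ D_c = N_{Π_I}(c^Ẑ × 1)` (the twist fixes the commutator `[a,b]`). [cite: MochizukiAbsTopII2013, Def 1.2 (ii) p.10] -/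
theorem range_inr_le_normalizer_map_inl_cuspGp :
    (SemidirectProduct.inr : ZH →* Ext i).range ≤
      Subgroup.normalizer ((cuspGp.map (SemidirectProduct.inl : F₂hatT →* Ext i) : Subgroup (Ext i)) : Set (Ext i)) :=
  le_trans (normalizer_node_inf_normalizer_cusp_eq_range_inr i).ge inf_le_right

/-- The twist generator `(1, k)`, `k ≠ 1`, is not in `Π_𝔾 = F̂₂ × 1`. [cite: MochizukiAbsTopII2013, Def 1.2 (ii) p.10] -/
theorem inr_not_mem_range_inl {k : ZH} (hk : k ≠ 1) :
    (SemidirectProduct.inr k : Ext i) ∉ (SemidirectProduct.inl : F₂hatT →* Ext i).range := by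
  rintro ⟨n, hn⟩
  have hr := congrArg SemidirectProduct.right hn
  rw [SemidirectProduct.right_inl, SemidirectProduct.right_inr] at hr
  exact hk hr.symm

/-- **`Z_{Π_I}(Π_𝔾) = 1` in `Π_I = F̂₂ ⋊_{shear^i} Ẑ`, `i ≥ 1`.**  An element centralising `F̂₂ × 1` centralises
`Π_v × 1`, so lies in `Z_{Π_I}(Π_v × 1) = 1 ⋊ Ẑ` (`Z_{F̂₂}(Π_v) = 1`, `DehnTwistLoopProp13ii.lean`); and `(1,k)` conjugates the stable letter
`(a,1)` to `(a·b^{k^i}, 1)`, which is `(a,1)` only if `b^{k^i} = 1`, i.e. `k^i = 1`, i.e. `k = 1` (`Ẑ` torsion-free).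
[cite: MochizukiAbsTopII2013, Def 1.2 (ii) p.10] -/
theorem centralizer_range_inl_eq_bot {i : ℕ} (hi : 0 < i) :
    Subgroup.centralizer (((SemidirectProduct.inl : F₂hatT →* Ext i).range : Subgroup (Ext i)) : Set (Ext i)) = ⊥ := by
  rw [eq_bot_iff]
  intro x hx
  -- `x` centralises `Π_v × 1 ≤ Π_𝔾`, hence `x ∈ Z(Π_v × 1) ∩ Π_I = 1 ⋊ Ẑ`
  have hxv : x ∈ Subgroup.centralizer ((vertGp.map (SemidirectProduct.inl : F₂hatT →* Ext i) : Subgroup (Ext i)) :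
      Set (Ext i)) ⊓ (⊤ : Subgroup (Ext i)) :=
    Subgroup.mem_inf.mpr ⟨Subgroup.centralizer_le (SetLike.coe_subset_coe.mpr (Subgroup.map_le_range _ _)) hx,
      Subgroup.mem_top _⟩
  rw [centralizer_vert_inf_top_eq i centralizer_vertGp_eq_bot] at hxv
  obtain ⟨k, rfl⟩ := hxv
  -- `(1,k)` commutes with the stable letter `(a,1)`
  have ha : (SemidirectProduct.inl (eta (FreeGroup.of 0)) : Ext i) * SemidirectProduct.inr k =
      SemidirectProduct.inr k * SemidirectProduct.inl (eta (FreeGroup.of 0)) :=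
    Subgroup.mem_centralizer_iff.mp hx _ ⟨eta (FreeGroup.of 0), rfl⟩
  have hleft := congrArg SemidirectProduct.left ha
  simp only [SemidirectProduct.mul_left, SemidirectProduct.left_inl, SemidirectProduct.right_inl, map_one,
    SemidirectProduct.left_inr, mul_one, one_mul, SemidirectProduct.right_inr] at hleft
  -- `a = shear^{k}(a) = a · b^{k^i}`
  rw [shearPow_eta_zero] at hleft
  have hb : bPow (k ^ i) = 1 := by
    have := congrArg (fun y => (eta (FreeGroup.of 0))⁻¹ * y) hleft
    simpa using this.symm
  have hki : k ^ i = 1 := bPow_injective (by rw [hb, map_one])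
  rw [ZHatCompletion.eq_one_of_pow_eq_one hi.ne' hki, map_one]
  exact Subgroup.one_mem _

section Dpsc

variable {i} (hi : 0 < i)

/-- **`I_v = 1 ⋊ Ẑ ≤ D_ε` for EVERY edge `ε` of the loop graph** (the node and the cusp).
[cite: MochizukiAbsTopII2013, Def 1.2 (ii) p.10] -/
theorem Iv_le_DEdge_dpsc (v : (dpsc i hi).Vert) (ε : (dpsc i hi).Edge) : (dpsc i hi).Iv v ≤ (dpsc i hi).DEdge ε := by
  rw [Iv_dpsc_eq_range_inr_holds hi v]
  rcases ε with e | c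
  · exact range_inr_le_normalizer_map_inl_nodeGp i
  · exact range_inr_le_normalizer_map_inl_cuspGp i

/-- **Every `Π_H`-conjugate of an edge decomposition group is a `Π_𝔾`-conjugate** at the nodal Dehn-twist datum:
`g = (γ,1)·(1,k)` with `(1,k) ∈ I_v ≤ D_ε`, so `g D_ε g⁻¹ = (γ,1) D_ε (γ,1)⁻¹` (abc-iut-L4-t6's
`conj_smul_eq_conj_inl_left_smul`) — the outer action of `H = I` on `Π_𝔾` fixes the dual graph.
[cite: MochizukiAbsTopII2013, Def 1.2 (ii) p.10] -/
theorem exists_mem_PiG_conj_DEdge_eq_dpsc (g : (dpsc i hi).PiH) (ε : (dpsc i hi).Edge) :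
    ∃ γ : (dpsc i hi).PiH, γ ∈ (dpsc i hi).PiG ∧
      MulAut.conj g • (dpsc i hi).DEdge ε = MulAut.conj γ • (dpsc i hi).DEdge ε := by
  rcases ε with e | c
  · exact ⟨_, ⟨_, rfl⟩, conj_smul_eq_conj_inl_left_smul i (range_inr_le_normalizer_map_inl_nodeGp i) g⟩
  · exact ⟨_, ⟨_, rfl⟩, conj_smul_eq_conj_inl_left_smul i (range_inr_le_normalizer_map_inl_cuspGp i) g⟩

/-! ### §2 Prop 1.3 (viii), v1 typing (`Π_H`-scope), HOLDS at the datum -/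

/-- **[AbsTopII] Prop 1.3 (viii), v1 typing `DPSCIndexData.Prop_1_3_viii` (`Π_H`-conjugates of `D_{e'}`, `Π_H`-conjugate
of `I_v`) HOLDS at the one-vertex nodal Dehn-twist datum `dpsc i hi`, NO hypothesis** — through the printed-scope
instance `prop_1_3_viii'_dpsc_holds` (gen 7, p500779) and abc-iut-L4-t6's bridge `prop_1_3_viii_of_prop_1_3_viii'`
under «every `Π_H`-conjugate of `D_ε` is a `Π_𝔾`-conjugate».  Here `H = I = Ẑ` acts NON-trivially — faithfully, §4 —
on `Π_𝔾 = F̂₂`, but fixes every edge. [cite: MochizukiAbsTopII2013, Prop 1.3 (viii) p.12] -/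
theorem prop_1_3_viii_dpsc_holds :
    Literature.AnabelianGeometry.AbsoluteAnabelian.AbsTopII.DPSCIndexData.Prop_1_3_viii (dpsc i hi) :=
  (dpsc i hi).prop_1_3_viii_of_prop_1_3_viii' (prop_1_3_viii'_dpsc_holds hi)
    (exists_mem_PiG_conj_DEdge_eq_dpsc hi)

/-! ### §3 Prop 1.3 (x), the free-label typings v1 / v2, FAIL at the datum -/

/-- `I_v = 1 ⋊ Ẑ` is closed. [cite: MochizukiAbsTopII2013, Prop 1.3 (iii) p.11] -/
theorem isClosed_Iv_dpsc (v : (dpsc i hi).Vert) : IsClosed ((dpsc i hi).Iv v : Set (dpsc i hi).PiH) := by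
  rw [Iv_dpsc_eq_range_inr_holds hi v]
  exact isClosed_range_inr i

/-- **[AbsTopII] Prop 1.3 (x), v1 typing `DPSCIndexData.Prop_1_3_x` (free point-kind label, `Π_H`-scope) FAILS at the
one-vertex nodal Dehn-twist datum**: the labelled section (`I_v`, "the node `e`") is a legitimate `LogPointData`
whose label the typed node biconditional forces to be non-verticial — but `I_v` is verticial (abc-iut-L4-t6's
`not_prop_1_3_x_of_node`; inputs `I_v` closed and `I_v ∩ Π_𝔾 = 1`, `I_v·Π_𝔾 = Π_I` from `prop13iii_dpsc_holds`).  The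
statement of record `Prop_1_3_x''` HOLDS here (`prop_1_3_x''_dpsc_holds`). [cite: MochizukiAbsTopII2013, Prop 1.3 (x) p.12] -/
theorem not_prop_1_3_x_dpsc_holds :
    ¬ Literature.AnabelianGeometry.AbsoluteAnabelian.AbsTopII.DPSCIndexData.Prop_1_3_x (dpsc i hi) :=
  (dpsc i hi).not_prop_1_3_x_of_node ⟨()⟩ ⟨()⟩ (isClosed_Iv_dpsc hi ⟨()⟩) (prop13iii_dpsc_holds hi ⟨()⟩).1
    (prop13iii_dpsc_holds hi ⟨()⟩).2

/-- **[AbsTopII] Prop 1.3 (x), v2 typing `DPSCIndexData.Prop_1_3_x'` (free point-kind label, printed `Π_𝔾`-scope)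
FAILS at the one-vertex nodal Dehn-twist datum** — same labelled section (abc-iut-L4-t6's `not_prop_1_3_x'_of_node`).
[cite: MochizukiAbsTopII2013, Prop 1.3 (x) p.12] -/
theorem not_prop_1_3_x'_dpsc_holds :
    ¬ Literature.AnabelianGeometry.AbsoluteAnabelian.AbsTopII.DPSCIndexData.Prop_1_3_x' (dpsc i hi) :=
  (dpsc i hi).not_prop_1_3_x'_of_node ⟨()⟩ ⟨()⟩ (isClosed_Iv_dpsc hi ⟨()⟩) (prop13iii_dpsc_holds hi ⟨()⟩).1
    (prop13iii_dpsc_holds hi ⟨()⟩).2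

/-! ### §4 The outer action of `H = I` on `Π_𝔾` is faithful (honesty of "non-trivial") -/

/-- **`Z_{Π_I}(Π_𝔾) = 1` at the nodal Dehn-twist datum** (`centralizer_range_inl_eq_bot` in the DPSC vocabulary).
[cite: MochizukiAbsTopII2013, Def 1.2 (ii) p.10] -/
theorem centralizer_PiG_dpsc_eq_bot :
    Subgroup.centralizer ((dpsc i hi).PiG : Set (dpsc i hi).PiH) = ⊥ :=
  centralizer_range_inl_eq_bot hi

/-- **The outer representation `I → Out(Π_𝔾)` is injective**: an element of `Π_H = Π_I` acting on `Π_𝔾` as an INNER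
automorphism of `Π_𝔾` already lies in `Π_𝔾`. [cite: MochizukiAbsTopII2013, Def 1.2 (ii) p.10] -/
theorem mem_PiG_of_forall_conj_eq_dpsc (x γ : (dpsc i hi).PiH) (hγ : γ ∈ (dpsc i hi).PiG)
    (h : ∀ y ∈ (dpsc i hi).PiG, x * y * x⁻¹ = γ * y * γ⁻¹) : x ∈ (dpsc i hi).PiG := by
  -- `γ⁻¹ x` centralises `Π_𝔾`, hence is trivial
  have hc : γ⁻¹ * x ∈ Subgroup.centralizer ((dpsc i hi).PiG : Set (dpsc i hi).PiH) := by
    rw [Subgroup.mem_centralizer_iff]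
    intro y hy
    have hxy : x * y = γ * y * γ⁻¹ * x := by rw [← h y hy, inv_mul_cancel_right]
    calc y * (γ⁻¹ * x) = γ⁻¹ * (γ * y * γ⁻¹ * x) := by group
      _ = γ⁻¹ * (x * y) := by rw [hxy]
      _ = γ⁻¹ * x * y := by group
  rw [centralizer_PiG_dpsc_eq_bot hi, Subgroup.mem_bot, inv_mul_eq_one] at hc
  rw [← hc]
  exact hγ

/-- `Π_𝔾 ≠ Π_I` (`I = Ẑ ≠ 1`: the twist generator `(1, ι(1))` is not in `F̂₂ × 1`). [cite: MochizukiAbsTopII2013, Def 1.2 (ii) p.10] -/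
theorem PiG_ne_PiI_dpsc : (dpsc i hi).PiG ≠ (dpsc i hi).PiI := by
  intro h
  have hmem : (SemidirectProduct.inr (iotaZ (Multiplicative.ofAdd 1)) : Ext i) ∈ (dpsc i hi).PiG := by
    rw [h, dpsc_PiI]; exact Subgroup.mem_top _
  exact inr_not_mem_range_inl i iotaZ_one_ne_one hmem

/-! ### §5 Census existence form -/

/-- **A DPSC datum WITH A NODE whose outer action `H = I → Out(Π_𝔾)` is FAITHFUL and NON-trivial (`Z_{Π_I}(Π_𝔾) = 1`,
`Π_𝔾 ≠ Π_I`) at which the v1 `Π_H`-scope typing of Prop 1.3 (viii) HOLDS (together with the printed-scope (viii′)),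
while the free-label typings (x), (x′) FAIL, EXISTS** — so the ∀-closure of `Prop_1_3_viii` (refuted in the tree by
edge-MOVING outer actions, `Prop13ConjugacyScope.lean`) does not fail merely because the outer action is non-trivial.
[cite: MochizukiAbsTopII2013, Prop 1.3 (viii) p.12] -/
theorem exists_nodal_model_prop_1_3_viii_v1_of_faithful_outer_action (i : ℕ) (hi : 0 < i) :
    ∃ X : DPSCIndexData.{0}, Nonempty X.Node ∧
      Subgroup.centralizer (X.PiG : Set X.PiH) = ⊥ ∧ X.PiG ≠ X.PiI ∧
      Literature.AnabelianGeometry.AbsoluteAnabelian.AbsTopII.DPSCIndexData.Prop_1_3_viii X ∧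
      Literature.AnabelianGeometry.AbsoluteAnabelian.AbsTopII.DPSCIndexData.Prop_1_3_viii' X ∧
      ¬ Literature.AnabelianGeometry.AbsoluteAnabelian.AbsTopII.DPSCIndexData.Prop_1_3_x X ∧
      ¬ Literature.AnabelianGeometry.AbsoluteAnabelian.AbsTopII.DPSCIndexData.Prop_1_3_x' X :=
  ⟨dpsc i hi, dpsc_node_nonempty i hi, centralizer_PiG_dpsc_eq_bot hi, PiG_ne_PiI_dpsc hi,
    prop_1_3_viii_dpsc_holds hi, prop_1_3_viii'_dpsc_holds hi, not_prop_1_3_x_dpsc_holds hi,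
    not_prop_1_3_x'_dpsc_holds hi⟩

/-! ### §6 The complete typed Prop 1.3 column at the one-vertex nodal Dehn-twist datum -/

/-- **The cell's typed [AbsTopII] Prop 1.3 predicates (all twenty `def`s of `DecompositionGroups.lean`,
`DecompositionGroupsMoreover.lean`, `InertiaGroups.lean`, `InertiaGroupsScope.lean`, `InertiaGroupsBranchScope.lean`,
`InertiaGroupsCuspScope.lean`, `InertiaGroupsLogPoints.lean`; `LogPointData.Prop13x` enters through (x″)), ALL DECIDED at
the one-vertex nodal Dehn-twist datum `dpsc i hi` (`i ≥ 1`), NO hypothesis** — in print order: (i) · (ii) v1 · (ii′) · (iii) first clause · (iii′) · (iii″) ·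
(iv) v1 · (iv′) · (iv) «Moreover» · (v) · (v′) · (vi) · (vii) · (viii) v1 · (viii′) · (ix) HOLD; (x) v1 and (x′) v2
(free label) FAIL; (x″) (statement of record, for the model's log points `logPoints i hi`) HOLDS.  Each conjunct is the
named instance theorem of abc-iut-f-069 gens 3–8 / abc-iut-L4-t6 (`DehnTwist*.lean`).  Constructed ≠ geometric; typed ≠
the printed theorem; nothing here bears on [IUTchIII] Cor 3.12. [cite: MochizukiAbsTopII2013, Prop 1.3 pp.11–12] -/
theorem prop_1_3_typed_column_dpsc :
    Literature.AnabelianGeometry.AbsoluteAnabelian.AbsTopII.DPSCIndexData.Prop_1_3_i (dpsc i hi) ∧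
    Literature.AnabelianGeometry.AbsoluteAnabelian.AbsTopII.DPSCIndexData.Prop_1_3_ii (dpsc i hi) ∧
    Literature.AnabelianGeometry.AbsoluteAnabelian.AbsTopII.DPSCIndexData.Prop_1_3_ii' (dpsc i hi) ∧
    (dpsc i hi).toDPSCData.Prop13iii ∧
    Literature.AnabelianGeometry.AbsoluteAnabelian.AbsTopII.DPSCIndexData.Prop_1_3_iii' (dpsc i hi) ∧
    Literature.AnabelianGeometry.AbsoluteAnabelian.AbsTopII.DPSCIndexData.Prop_1_3_iii'' (dpsc i hi) ∧
    (dpsc i hi).toDPSCData.Prop13iv ∧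
    (dpsc i hi).toDPSCData.Prop13iv' ∧
    Literature.AnabelianGeometry.AbsoluteAnabelian.DPSCData.Prop13iv_moreover (dpsc i hi).toDPSCData ∧
    (dpsc i hi).toDPSCData.Prop13v ∧
    Literature.AnabelianGeometry.AbsoluteAnabelian.AbsTopII.DPSCIndexData.Prop_1_3_v' (dpsc i hi) ∧
    (dpsc i hi).toDPSCData.Prop13vi ∧
    (dpsc i hi).toDPSCData.Prop13vii ∧
    Literature.AnabelianGeometry.AbsoluteAnabelian.AbsTopII.DPSCIndexData.Prop_1_3_viii (dpsc i hi) ∧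
    Literature.AnabelianGeometry.AbsoluteAnabelian.AbsTopII.DPSCIndexData.Prop_1_3_viii' (dpsc i hi) ∧
    (dpsc i hi).toDPSCData.Prop13ix ∧
    ¬ Literature.AnabelianGeometry.AbsoluteAnabelian.AbsTopII.DPSCIndexData.Prop_1_3_x (dpsc i hi) ∧
    ¬ Literature.AnabelianGeometry.AbsoluteAnabelian.AbsTopII.DPSCIndexData.Prop_1_3_x' (dpsc i hi) ∧
    (dpsc i hi).Prop_1_3_x'' (logPoints i hi) :=
  ⟨prop_1_3_i_dpsc_holds hi, prop_1_3_ii_dpsc_holds hi, prop_1_3_ii'_dpsc_holds hi, prop13iii_dpsc_holds hi,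
    prop_1_3_iii'_dpsc_holds' hi, prop_1_3_iii''_dpsc_holds hi, prop13iv_dpsc_holds hi, prop13iv'_dpsc_holds hi,
    prop13iv_moreover_dpsc_holds hi, prop13v_dpsc_holds hi, prop_1_3_v'_dpsc_holds hi, prop13vi_dpsc_holds hi,
    prop13vii_dpsc_holds hi, prop_1_3_viii_dpsc_holds hi, prop_1_3_viii'_dpsc_holds hi, prop13ix_dpsc_holds hi,
    not_prop_1_3_x_dpsc_holds hi, not_prop_1_3_x'_dpsc_holds hi, prop_1_3_x''_dpsc_holds hi⟩

end Dpsc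

end Literature.AnabelianGeometry.AbsoluteAnabelian.AbsTopII.DehnTwist

end
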